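import Summits.AtomisticToContinuum.BoseEinsteinCondensation.Theorems.BECThomsonPrincipleGaussianDominationCanWardSplitComposition
import Literature.MathematicalPhysics.QuantumManyBody.PeriodicFeynmanKacFreeForm
import HarnessLib

/-!
# Line `ward-chord-splitting` of crux `GaussianDominationCan` (stmt-AtomisticToContinuum-9479): the bridge from `DensityResponse`

`weakDensityChord_of_densityResponse : BECThomsonPrinciple.DensityResponse → WeakDensityChord` — stub S2 of the line is a
corollary of the route's rank-4 sibling crux `DensityResponse` (stmt-AtomisticToContinuum-9481): drop `ρa ≥ 0` from the
denominator, translate all bosons by `t = (θ/|k|²)k` to produce the phase (`PeriodicTrialState.exists_translate`,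
`periodicEnergy_translate`, `setIntegral_cellN_comp_add_of_periodic`: same energy, shifted density wave), absorb the factor
`2` into `s ↦ s/2`.  Hence `gaussianDominationCan_of_densityResponse : S3 → S4 → DensityResponse → crux`: with the sibling
crux in place of S2 the line's open content is exactly S3 (backflow chord ⟺ c-number Gaussian domination) and S4 (the
normalisation lift).  [folklore]-level.
-/

noncomputable section

namespace Summit.AtomisticToContinuum.BoseEinsteinCondensation.Cruxes.GaussianDominationCan.WardChordSplitting

open MeasureTheory
open scoped ENNReal ComplexConjugate
open Literature.MathematicalPhysics.QuantumManyBody.BoseGas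
open Summit.AtomisticToContinuum.BoseEinsteinCondensation.Theses
open Summit.AtomisticToContinuum.BoseEinsteinCondensation.Theorems.GaussianDominationCan.Negative
open Summit.AtomisticToContinuum.BoseEinsteinCondensation.Cruxes.DensityResponse.ForceBalanceConstitutive
  (kvec ksq ksupSq ksupSq_le_ksq ksq_le_three_mul_ksupSq)

/-! ### S2 from the sibling crux: `DensityResponse → WeakDensityChord` (translation produces the phase) -/

section Bridge

variable {N : ℕ} {L : ℝ}

/-- `kₗ = (2π/L) nₗ`. [folklore] -/
theorem kvec_apply (L : ℝ) (n : Fin 3 → ℤ) (l : Fin 3) : kvec L n l = 2 * Real.pi / L * (n l : ℝ) := rfl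

/-- `k·x` is `C¹` (it is the continuous linear functional `(2π/L)∑ⱼ nⱼ πⱼ`, `modeCLM_apply`). [folklore] -/
theorem contDiff_karg (L : ℝ) (n : Fin 3 → ℤ) : ContDiff ℝ 1 (karg L n) := by
  have h : karg L n = fun x => ((2 * Real.pi / L) • ∑ j : Fin 3,
      (n j : ℝ) • PiLp.proj 2 (fun _ : Fin 3 => ℝ) j : Space →L[ℝ] ℝ) x :=
    funext fun x => (modeCLM_apply L n x).symm
  rw [h]
  exact ContinuousLinearMap.contDiff _

/-- `k·(x + L eₗ) = k·x + 2π nₗ` for `L ≠ 0`. [folklore] -/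
theorem karg_add_single (hL : L ≠ 0) (n : Fin 3 → ℤ) (x : Space) (l : Fin 3) :
    karg L n (x + EuclideanSpace.single l L) = karg L n x + 2 * Real.pi * (n l : ℝ) := by
  unfold karg
  have : ∑ j, (n j : ℝ) * (x + EuclideanSpace.single l L) j = (∑ j, (n j : ℝ) * x j) + (n l : ℝ) * L := by
    simp only [PiLp.add_apply, PiLp.single_apply, mul_add, Finset.sum_add_distrib, mul_ite,
      mul_zero, Finset.sum_ite_eq', Finset.mem_univ, if_true]
  rw [this, mul_add]
  congr 1
  field_simp

/-- `k·(x + y) = k·x + k·y`. [folklore] -/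
theorem karg_add (L : ℝ) (n : Fin 3 → ℤ) (x y : Space) : karg L n (x + y) = karg L n x + karg L n y := by
  unfold karg
  rw [← mul_add, ← Finset.sum_add_distrib]
  congr 1
  refine Finset.sum_congr rfl fun j _ => ?_
  rw [PiLp.add_apply, mul_add]

/-- `k·(x - y) = k·x - k·y`. [folklore] -/
theorem karg_sub (L : ℝ) (n : Fin 3 → ℤ) (x y : Space) : karg L n (x - y) = karg L n x - karg L n y := by
  have h := karg_add L n (x - y) y
  rw [sub_add_cancel] at h
  linarith

/-- `k·(c k) = c|k|²`. [folklore] -/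
theorem karg_smul_kvec (L : ℝ) (n : Fin 3 → ℤ) (c : ℝ) : karg L n (c • kvec L n) = c * ksq L n := by
  unfold karg ksq
  simp only [PiLp.smul_apply, smul_eq_mul, kvec_apply, Finset.mul_sum]
  refine Finset.sum_congr rfl fun j _ => ?_
  ring

/-- `cos(k·(x + L e_l) + c) = cos(k·x + c)`. [folklore] -/
theorem cos_karg_add_single (hL : L ≠ 0) (n : Fin 3 → ℤ) (c : ℝ) (x : Space) (l : Fin 3) :
    Real.cos (karg L n (x + EuclideanSpace.single l L) + c) = Real.cos (karg L n x + c) := by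
  rw [karg_add_single hL, show karg L n x + 2 * Real.pi * (n l : ℝ) + c =
    karg L n x + c + (n l : ℤ) * (2 * Real.pi) by ring, Real.cos_add_int_mul_two_pi]

/-- The density-wave integrand with phase `c` is periodic in every particle and axis. [folklore] -/
theorem densityIntegrand_periodic (hL : L ≠ 0) (n : Fin 3 → ℤ) (c : ℝ) (Φ : PeriodicTrialState N L)
    (Y : Config N) (j : Fin N) (k : Fin 3) :
    (∑ i : Fin N, Real.cos (karg L n ((Y + Pi.single j (EuclideanSpace.single k L) : Config N) i) + c)) *
        ‖Φ.ψ (Y + Pi.single j (EuclideanSpace.single k L))‖ ^ 2 =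
      (∑ i : Fin N, Real.cos (karg L n (Y i) + c)) * ‖Φ.ψ Y‖ ^ 2 := by
  rw [Φ.periodic]
  congr 1
  refine Finset.sum_congr rfl fun i _ => ?_
  rcases eq_or_ne i j with rfl | hij
  · rw [Pi.add_apply, Pi.single_eq_same, cos_karg_add_single hL]
  · rw [Pi.add_apply, Pi.single_eq_of_ne hij, add_zero]

/-- **Translation produces the phase**: for the translate `Ψ = Φ(· - t𝟙)` (`PeriodicTrialState.exists_translate`),
`D_0(Ψ) = D_{k·t}(Φ)` (shift of the fundamental cell, `setIntegral_cellN_comp_add_of_periodic`). [folklore] -/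
theorem densityWave_translate (hL : 0 < L) (n : Fin 3 → ℤ) (Φ : PeriodicTrialState N L) (t : Space)
    {Ψ : PeriodicTrialState N L} (hΨ : Ψ.ψ = fun X => Φ.ψ (X - fun _ => t)) :
    densityWave 0 n Ψ = densityWave (karg L n t) n Φ := by
  unfold densityWave
  set G : Config N → ℝ := fun Y => (∑ i : Fin N, Real.cos (karg L n (Y i) + karg L n t)) * ‖Φ.ψ Y‖ ^ 2
    with hG
  have hper : ∀ (Y : Config N) (j : Fin N) (k : Fin 3),
      G (Y + Pi.single j (EuclideanSpace.single k L)) = G Y := fun Y j k =>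
    densityIntegrand_periodic hL.ne' n (karg L n t) Φ Y j k
  have hkarg : Continuous (karg L n) := (contDiff_karg L n).continuous
  have hcont : Continuous G :=
    (continuous_finsetSum _ fun i _ => Real.continuous_cos.comp
      ((hkarg.comp (continuous_apply i)).add continuous_const)).mul ((Φ.contDiff.continuous.norm).pow 2)
  have hshift := setIntegral_cellN_comp_add_of_periodic hL
    (hcont.aestronglyMeasurable.restrict) hper (-(fun _ => t))
  have hint : (fun X : Config N => (∑ i : Fin N, Real.cos (karg L n (X i) + 0)) * ‖Ψ.ψ X‖ ^ 2) =
      fun X => G (X + -(fun _ => t)) := by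
    funext X
    rw [hΨ, hG]
    simp only
    rw [show X + -(fun _ : Fin N => t) = X - fun _ => t from (sub_eq_add_neg X _).symm]
    congr 1
    refine Finset.sum_congr rfl fun i _ => ?_
    rw [add_zero, Pi.sub_apply, karg_sub, sub_add_cancel]
  rw [hint, hshift]

/-- **`DensityResponse ⟹ WeakDensityChord`**: S2 follows from the route's rank-4 crux — drop `ρa ≥ 0` from the
denominator, translate by `t = (θ/|k|²)k` to produce the phase (`periodicEnergy_translate`: same energy), and absorb
the route's factor `2` into `s ↦ s/2`; `C₂ := C`, `ρ₀, N₀` unchanged. So `stub_weakDensityChord` closes the moment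
`DensityResponse` lands (apply this theorem to the landed proof). -/
theorem weakDensityChord_of_densityResponse (hD : BECThomsonPrinciple.DensityResponse) : WeakDensityChord := by
  intro v hv M hM
  obtain ⟨ρ₀, C, hρ₀, hC, N₀, h⟩ := hD v hv M hM
  refine ⟨ρ₀, C, hρ₀, hC, N₀, ?_⟩
  intro N hN L hL hNL n hn hwin θ s hs Φ
  -- the translate carrying the phase
  have hk : 0 < ksq L n := ksq_pos hL.ne' hn
  set t : Space := (θ / ksq L n) • kvec L n with ht
  have hkt : karg L n t = θ := by rw [ht, karg_smul_kvec]; field_simp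
  obtain ⟨Ψ, hΨ⟩ := Φ.exists_translate t
  have hEΨ : periodicEnergy v Ψ = periodicEnergy v Φ := periodicEnergy_translate v Φ t hΨ
  have hDΨ : densityWave 0 n Ψ = densityWave θ n Φ := by rw [densityWave_translate hL n Φ t hΨ, hkt]
  -- the route's source at `Ψ` is `2 D_0(Ψ)`
  have hsrc : ∫ X in cellN N L, (∑ i, 2 * Real.cos (2 * Real.pi / L * ∑ j, (n j : ℝ) * X i j)) * ‖Ψ.ψ X‖ ^ 2
      = 2 * densityWave 0 n Ψ := by
    unfold densityWave
    rw [← integral_const_mul]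
    refine integral_congr_ae (Filter.Eventually.of_forall fun X => ?_)
    simp only [karg, add_zero]
    rw [← Finset.mul_sum]
    ring
  -- `DensityResponse` at `(s/2, Ψ)`
  have key := h N hN L hL hNL n hn hwin (s / 2) (by positivity) Ψ
  rw [hsrc, hEΨ, hDΨ] at key
  have e1 : s / 2 * |2 * densityWave θ n Φ| = s * |densityWave θ n Φ| := by
    rw [abs_mul, abs_two]; ring
  rw [e1] at key
  refine key.trans (add_le_add le_rfl (ENNReal.ofReal_le_ofReal ?_))
  -- budgets: `C (s/2)² N/(k∞² + ρa) ≤ C s² N L²/‖n‖²`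
  have hnorm : 1 ≤ ‖(fun j => (n j : ℝ))‖ := one_le_norm_intVec hn
  have hks : 0 < (2 * Real.pi * ‖(fun j => (n j : ℝ))‖ / L) ^ 2 := by positivity
  have hden : (2 * Real.pi * ‖(fun j => (n j : ℝ))‖ / L) ^ 2 ≤
      (2 * Real.pi * ‖(fun j => (n j : ℝ))‖ / L) ^ 2 + (N : ℝ) / L ^ 3 * (scatteringLength v).toReal := by
    have : 0 ≤ (N : ℝ) / L ^ 3 * (scatteringLength v).toReal := by positivity
    linarith
  calc C * (s / 2) ^ 2 * N / ((2 * Real.pi * ‖(fun j => (n j : ℝ))‖ / L) ^ 2 +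
        N / L ^ 3 * (scatteringLength v).toReal)
      ≤ C * (s / 2) ^ 2 * N / (2 * Real.pi * ‖(fun j => (n j : ℝ))‖ / L) ^ 2 := by
        apply div_le_div_of_nonneg_left (by positivity) hks hden
    _ = C * s ^ 2 * N * L ^ 2 / ‖(fun j => (n j : ℝ))‖ ^ 2 * (1 / (16 * Real.pi ^ 2)) := by
        field_simp
        ring
    _ ≤ C * s ^ 2 * N * L ^ 2 / ‖(fun j => (n j : ℝ))‖ ^ 2 * 1 := by
        refine mul_le_mul_of_nonneg_left ?_ (by positivity)
        rw [div_le_one (by positivity)]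
        nlinarith [Real.pi_gt_three]
    _ = C * s ^ 2 * N * L ^ 2 / ‖(fun j => (n j : ℝ))‖ ^ 2 := mul_one _

/-- The registered stub S2 as a corollary of the sibling crux, in the audit's vocabulary. [folklore] -/
theorem stub_weakDensityChord_of_densityResponse :
    BECThomsonPrinciple.DensityResponse → Goal.stub_weakDensityChord :=
  fun hD => weakDensityChord_of_densityResponse hD

end Bridge

/-- **Variant composition through the sibling crux**: the route item `DensityResponse` (rank 4) in place of S2 —
so the crux is `DensityResponse ∧ S3 ∧ S4` with everything else proved. [folklore] -/
theorem gaussianDominationCan_of_densityResponse :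
    Goal.stub_backflowChord → Goal.stub_normalisationLift → BECThomsonPrinciple.DensityResponse →
      BECThomsonPrinciple.GaussianDominationCan :=
  fun h₃ h₄ hD => gaussianDominationCan_of_stubs (weakDensityChord_of_densityResponse hD) h₃ h₄

end Summit.AtomisticToContinuum.BoseEinsteinCondensation.Cruxes.GaussianDominationCan.WardChordSplitting

end
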